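import Summits.BirchSwinnertonDyer.BirchSwinnertonDyer.Theorems.SignedLowerHalvesSprungLowerDivisibilityAtThreeColourTransfer
import Summits.BirchSwinnertonDyer.BirchSwinnertonDyer.Theorems.SignedLowerHalvesSprungLowerDivisibilityAtThreeStubPeriodMu
import Literature.NumberTheory.EllipticCurves.Sprung2012.SharpFlatKatoDivisibility
import Literature.NumberTheory.EllipticCurves.Kato2004.IwasawaCohomologyExistsProofs
import Literature.NumberTheory.EllipticCurves.KatoFineSelmerDualProofs
import Literature.NumberTheory.EllipticCurves.SkinnerUrban2014.CharacteristicIdealBaseChangeProofs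
import Literature.NumberTheory.EllipticCurves.KatoRankBoundMultiplicativeProofs
import HarnessLib

/-!
# Crux `SprungLowerDivisibilityAtThree` (K1, item stmt-BirchSwinnertonDyer-19875), line `chromatic-common-zeros`:
# KATO'S MAIN IDENTITY ON A ♯/♭ PACKAGE ⟹ K1 FOR THAT COLOUR, per pair — Sprung 2012 Prop. 7.19 / Kato 2004 §17.13 run in the
# kernel (the adapter through which any Kato-type engine at `(3, a₃ = ±3)` — Kurihara numbers, Fouquet–Wan — reaches K1)

Cell `bsd-ssimc` (host), width seat `cruxlead-stmt-BirchSwinnertonDyer-19875-w2` (g3) under the 19875 lead; `--supports` 19875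
`--as helper`; theorems only; route-independent imports; closes NO item; registry unchanged (skeleton v8). K1, Kato's main conjecture,
BSD and leaf X8 are NOT proved by anything here — the main identity is a displayed HYPOTHESIS of every theorem below.

## Why this file

After the v7/v8 re-cut the residue of the line is Kato-currency: K_spor (Kato 2004 Conj. 12.10, Eisenstein half, at the sporadic
common zeros) and S4b-cyc, and ON CLASS X8 `K1 (both colours) ⟺ KFL(W)` (the lead's p617250). Every ENGINE in print or preprint that
could discharge this per pair or on a locus delivers KATO'S MAIN IDENTITY — the equality `char_Λ(Sel₀(ℚ_∞, E[3^∞])^∨) = char_Λ(𝐇¹/Z)`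
read on a Coleman–Kato package: the tree's binders `Kim2026.thm111_katoMainIdentity_of_kuriharaNumber_ne_zero` (p ≥ 5),
`KimKimSun2020.thm11_…_three_OPEN` (unit Kurihara number at 3, claim-grade), `FouquetWan2021.thm451_katoMainIdentity_OPEN` all conclude
`∃ d, Module.charIdeal Λ Y.X = Module.charIdeal Λ (I.H ⧸ d.Z)` on Kobayashi's `η = 1` package (class `a_p = 0`), and the kernel descent
to the signed main conjecture is Kobayashi's Thm. 7.4 run in the kernel (`KuriharaRigidity.kobayashiMainConjecture_of_katoMainConjectureFrame`,
line `kurihara_rigidity` of crux 3). THIS FILE is the ♯/♭ twin of that descent for class X8: the identity read on Sprung's package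
`Sprung2012.SharpFlatColemanKatoData` (whose existence is the named fact `thm714seq_sharpFlatColemanKato_zeta`) implies K1's predicate
`SprungSharpFlatLowerDivisibility W 3 •` for that colour — Sprung 2012 Prop. 7.19 («Kato's [C] 7.20 ⟺ Main [C] 7.21 for every colour with
`L^• ≠ 0`») in the Eisenstein direction, via the four-term identity `SharpFlatColemanKatoData.eisenstein_iff_fine` (p607724) and the
globalisation `exists_generator_eq_periodNormalised_mul_of_lengthAt_quotient_le` (p606658). So a future ♯/♭ reading of a Kato engine at
`(3, ±3)` (a typing task; DOSSIER-19875 §6 (i): the binder must conclude the INTERMEDIATE object, Kato's identity — not K1) plugs into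
K1 by name through §2, both colours through §3.

## Contents

* §1 (module bookkeeping on a package `C` of colour `•` with `L^• ≠ 0`): `𝐇¹` is finitely generated (it embeds into `Λ` by `Col^•`,
  `SharpFlatColemanKatoData.moduleFinite_H`); `𝐇¹/Z` is torsion (`Col^•(Z) ∋ s·G^• ≠ 0`, `…isTorsion_quotient_zeta`); the fine dual `Y.X`
  is finitely generated torsion as a quotient of `X^•` (`…moduleFinite_fine`, `…isTorsion_fine`, from the exact sequence (3)).
* §2 `sprungSharpFlatLowerDivisibility_of_katoMainIdentity` — **per X8 pair and colour `•`: Kato's main identity on the `•`-package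
  (for every frame, pinned `I` and fine dual `Y`, SOME package datum `d` with `char Y.X = char (I.H ⧸ d.Z)`) ⟹ `SprungSharpFlatLowerDivisibility W p •`**,
  modulo `h714` (Sprung 2012 Thm. 7.14: `X^•` f.g. torsion when `L^• ≠ 0`) and `h3` (period unit at 3, for the Néron normalisation
  `G^•`): equality of characteristic ideals of finitely generated torsion modules gives `ℓ_𝔭(I.H/d.Z) ≤ ℓ_𝔭 Y.X` at every height-one `𝔭`
  (Skinner–Urban §3.1.6, `lengthAt_le_of_charIdeal_le`), `eisenstein_iff_fine` turns it into `ℓ_𝔭 Λ/(G^•) ≤ ℓ_𝔭 X^•`, and the UFD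
  globalisation gives `char X^• = (G^•·h)`. Only the `⊇ char(𝐇¹/Z)`-half of the identity is used (`…_of_katoFineInclusion`).
* §3 `lowerDivisibility_of_katoMainIdentity` — both colours at the pair from the identity on both packages.

References: [Sprung2012] Def. 6.1 (p. 1495), Thm. 7.14 (3) (p. 1504), Prop. 7.17, Prop. 7.19, [C] 7.20, Main [C] 7.21 (p. 1505); [Kato2004Asterisque]
Thm. 12.5/12.6 (p. 222), Conj. 12.10 (p. 224), §17.13 (p. 280); [Kobayashi2003] Thm. 7.4 (p. 13); [SkinnerUrban2014] §3.1.6; [Washington1997] §13.2;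
tree: `…ColourTransfer` (p607724), `…CharIdealLowerGlue` (p606658), `…StubPeriodMu` (p606253), `…KatoFineLowerIff` (p617250),
`KimKimSun2020/KatoMainIdentityOfUnitKuriharaNumberThreeOPEN` (p614127), `FouquetWan2021/KatoMainIdentityCrystallineOPEN`.
-/

set_option linter.dupNamespace false
set_option autoImplicit false

noncomputable section

open scoped Classical NumberField MatrixGroups ModularForm

open NumberField IsDedekindDomain CongruenceSubgroup WeierstrassCurve Field
  Literature.NumberTheory.EllipticCurves Literature.NumberTheory.EllipticCurves.ModularForms
  Literature.NumberTheory.EllipticCurves.ZpExtension Literature.NumberTheory.EllipticCurves.Sprung2017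
  Literature.NumberTheory.EllipticCurves.Sprung2012 Literature.NumberTheory.EllipticCurves.Rank1Residual
  Literature.NumberTheory.EllipticCurves.IwasawaAlgebra Literature.NumberTheory.EllipticCurves.Kato2004
  Literature.NumberTheory.EllipticCurves.Module
  Summit.BirchSwinnertonDyer.BirchSwinnertonDyer.Theorems
  Summit.BirchSwinnertonDyer.BirchSwinnertonDyer.Theorems.SmallImageSignedMuDefect
  Summit.BirchSwinnertonDyer.Rank1Residual.Supersingular

namespace Summit.BirchSwinnertonDyer.BirchSwinnertonDyer.Theorems.ChromaticCommonZeros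

/-! ### §1 Module bookkeeping on a ♯/♭ Coleman–Kato package -/

section Package

variable (W : WeierstrassCurve ℚ) [W.IsElliptic] (p : ℕ) [Fact p.Prime]
  [ContinuousSMul ℤ_[p] (W.tateModule p)] [Module.Free ℤ_[p] (W.tateModule p)]
  [Module.Finite ℤ_[p] (W.tateModule p)]
  {N : ℕ} {f : CuspForm (Gamma0 N) 2} {ϖ : ℚ} {κ : ZpExtension ℚ p} {γ : absoluteGaloisGroup ℚ}
  {E : Type} [Field E] [Algebra ℚ E] {ι : AlgebraicClosure ℚ →ₐ[ℚ] AlgebraicClosure E} {ap : ℤ}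
  {g : absoluteGaloisGroup E} {c : ℕ → localPoints W E} {col : Chroma} {I : IwasawaH1Data W p κ γ}

/-- **`𝐇¹` is a finitely generated `Λ`-module** on a package of colour `•` with `L^• ≠ 0`: `Col^• : 𝐇¹ → Λ` is injective
(Sprung 2012 Thm. 7.14, proof of (3)) and `Λ` is Noetherian. [cite: Sprung2012, Thm. 7.14 (3) (p. 1504)] -/
theorem _root_.Literature.NumberTheory.EllipticCurves.Sprung2012.SharpFlatColemanKatoData.moduleFinite_H
    (C : SharpFlatColemanKatoData W p f ϖ κ γ ι ap g c col I) {Lsharp Lflat : IwasawaAlgebra p}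
    (hSP : IsSprungPair f p ap Lsharp Lflat) (hcol : chromaticL col Lsharp Lflat ≠ 0) :
    Module.Finite (IwasawaAlgebra p) I.H :=
  Module.Finite.of_injective C.colMap (C.colMap_injective Lsharp Lflat hSP hcol)

/-- **`𝐇¹/Z` is a torsion `Λ`-module** on a package of colour `•` with `L^• ≠ 0`, `E[p]` irreducible and a non-zero Néron-normalised
`G^•`: by Def. 6.1 read on ideals (`image_zeta_localized` at the height-one prime `(p)`) some `s ≠ 0` has `s·G^• = Col^•(z₀)` with
`z₀ ∈ Z`, and then `(s·G^•)·x = Col^•(x)·z₀ ∈ Z` for every `x ∈ 𝐇¹` (injectivity of `Col^•`).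
[cite: Sprung2012, Def. 6.1 (p. 1495), Thm. 7.14 (3) (p. 1504)] [cite: Kato2004Asterisque, Thm. 12.6 (p. 222)] -/
theorem _root_.Literature.NumberTheory.EllipticCurves.Sprung2012.SharpFlatColemanKatoData.isTorsion_quotient_zeta
    (C : SharpFlatColemanKatoData W p f ϖ κ γ ι ap g c col I) (hirr : W.HasIrreducibleModPGaloisRep p)
    {Lsharp Lflat G₁ : IwasawaAlgebra p} (hSP : IsSprungPair f p ap Lsharp Lflat) (hcol : chromaticL col Lsharp Lflat ≠ 0)
    (hG₁ : iwasawaToPowerSeries p G₁ =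
      PowerSeries.C ((ϖ : ℚ) : ℚ_[p]) * iwasawaToPowerSeries p (chromaticL col Lsharp Lflat))
    (hG0 : G₁ ≠ 0) : Module.IsTorsion (IwasawaAlgebra p) (I.H ⧸ C.Z) := by
  -- the height-one prime `(p)`
  haveI : (augIdealP p).IsPrime := isPrime_augIdealP_holds p
  let 𝔭 : PrimeSpectrum (IwasawaAlgebra p) := ⟨augIdealP p, inferInstance⟩
  have h𝔭 : 𝔭.asIdeal.height = 1 := height_augIdealP_holds p
  obtain ⟨s, hs, hsG, -⟩ := C.image_zeta_localized hirr Lsharp Lflat G₁ hSP hG₁ 𝔭 h𝔭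
  have hs0 : s ≠ 0 := fun h0 => hs (h0 ▸ 𝔭.asIdeal.zero_mem)
  have hsG0 : s * G₁ ≠ 0 := mul_ne_zero hs0 hG0
  obtain ⟨z₀, hz₀, hz₀eq⟩ := Submodule.mem_map.mp hsG
  intro x
  obtain ⟨y, rfl⟩ := Submodule.Quotient.mk_surjective C.Z x
  refine ⟨⟨s * G₁, mem_nonZeroDivisors_of_ne_zero hsG0⟩, ?_⟩
  -- `(s G₁) • y = Col(y) • z₀`, which lies in `Z`
  have hin : (s * G₁) • y = C.colMap y • z₀ := by
    apply C.colMap_injective Lsharp Lflat hSP hcol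
    rw [map_smul, map_smul, smul_eq_mul, smul_eq_mul, hz₀eq, mul_comm]
  change (s * G₁) • Submodule.Quotient.mk y = (0 : I.H ⧸ C.Z)
  rw [← Submodule.Quotient.mk_smul, hin, Submodule.Quotient.mk_eq_zero]
  exact C.Z.smul_mem _ hz₀

/-- **The fine dual `Y.X` is finitely generated** when `X^•` is: the exact sequence (3) of Thm. 7.14 ends with a surjection `X^• ↠ X₀`.
[cite: Sprung2012, Thm. 7.14 (3) (p. 1504), Prop. 7.17] -/
theorem _root_.Literature.NumberTheory.EllipticCurves.Sprung2012.SharpFlatColemanKatoData.moduleFinite_fine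
    (C : SharpFlatColemanKatoData W p f ϖ κ γ ι ap g c col I) (D : SharpFlatSelmerDualData W κ γ ι ap g c col)
    [Module.Finite (IwasawaAlgebra p) D.X] (Y : W.FineSelmerDualData κ γ) : Module.Finite (IwasawaAlgebra p) Y.X := by
  obtain ⟨j, k, -, -, hk⟩ := C.exact D Y
  exact Module.Finite.of_surjective k hk

/-- **The fine dual `Y.X` is torsion** when `X^•` is (same surjection). [cite: Sprung2012, Thm. 7.14 (3) (p. 1504), Prop. 7.17] -/
theorem _root_.Literature.NumberTheory.EllipticCurves.Sprung2012.SharpFlatColemanKatoData.isTorsion_fine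
    (C : SharpFlatColemanKatoData W p f ϖ κ γ ι ap g c col I) (D : SharpFlatSelmerDualData W κ γ ι ap g c col)
    (hXt : Module.IsTorsion (IwasawaAlgebra p) D.X) (Y : W.FineSelmerDualData κ γ) :
    Module.IsTorsion (IwasawaAlgebra p) Y.X := by
  obtain ⟨j, k, -, -, hk⟩ := C.exact D Y
  intro y
  obtain ⟨x, rfl⟩ := hk y
  obtain ⟨a, ha⟩ := @hXt x
  refine ⟨a, ?_⟩
  rw [Submonoid.smul_def, ← map_smul, ← Submonoid.smul_def, ha, map_zero]

/-- **Kato's fine INCLUSION on the package gives the local Eisenstein inequality at every height-one prime.** For a package `C` of colour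
`•` (`L^• ≠ 0`, `E[p]` irreducible, Néron-normalised `G^• ≠ 0`), a dual datum `D` of `Sel^•` finitely generated torsion and a fine dual
`Y` with `char Y.X ⊆ char (I.H ⧸ C.Z)` («`X₀` at least as long as the zeta index», the Eisenstein half of Kato's Conj. 12.10 read on the
package): `ℓ_𝔭 Λ/(G^•) ≤ ℓ_𝔭 X^•` — Skinner–Urban §3.1.6 (`lengthAt_le_of_charIdeal_le`) then the four-term identity
(`eisenstein_iff_fine`, Sprung Prop. 7.19 / Kato §17.13). [cite: Sprung2012, Prop. 7.19 (p. 1505)] [cite: Kato2004Asterisque, Conj. 12.10 (p. 224), §17.13 (p. 280)]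
[cite: SkinnerUrban2014, §3.1.6 (p. 20)] -/
theorem _root_.Literature.NumberTheory.EllipticCurves.Sprung2012.SharpFlatColemanKatoData.lengthAt_quotient_le_of_fine_charIdeal_le
    (C : SharpFlatColemanKatoData W p f ϖ κ γ ι ap g c col I) (hirr : W.HasIrreducibleModPGaloisRep p)
    {Lsharp Lflat G₁ : IwasawaAlgebra p} (hSP : IsSprungPair f p ap Lsharp Lflat) (hcol : chromaticL col Lsharp Lflat ≠ 0)
    (hG₁ : iwasawaToPowerSeries p G₁ =
      PowerSeries.C ((ϖ : ℚ) : ℚ_[p]) * iwasawaToPowerSeries p (chromaticL col Lsharp Lflat))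
    (hG0 : G₁ ≠ 0) (D : SharpFlatSelmerDualData W κ γ ι ap g c col) [Module.Finite (IwasawaAlgebra p) D.X]
    (hXt : Module.IsTorsion (IwasawaAlgebra p) D.X) (Y : W.FineSelmerDualData κ γ)
    (hfine : Module.charIdeal (IwasawaAlgebra p) Y.X ≤ Module.charIdeal (IwasawaAlgebra p) (I.H ⧸ C.Z))
    (𝔭 : PrimeSpectrum (IwasawaAlgebra p)) (h𝔭 : 𝔭.asIdeal.height = 1) :
    Module.lengthAt (IwasawaAlgebra p) (IwasawaAlgebra p ⧸ Ideal.span {G₁}) 𝔭 ≤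
      Module.lengthAt (IwasawaAlgebra p) D.X 𝔭 := by
  haveI : Module.Finite (IwasawaAlgebra p) I.H := C.moduleFinite_H W p hSP hcol
  haveI : Module.Finite (IwasawaAlgebra p) Y.X := C.moduleFinite_fine W p D Y
  have hYt : Module.IsTorsion (IwasawaAlgebra p) Y.X := C.isTorsion_fine W p D hXt Y
  have hZt : Module.IsTorsion (IwasawaAlgebra p) (I.H ⧸ C.Z) := C.isTorsion_quotient_zeta W p hirr hSP hcol hG₁ hG0
  have hle := SkinnerUrban2014.lengthAt_le_of_charIdeal_le hYt hZt hfine 𝔭 h𝔭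
  exact (C.eisenstein_iff_fine W p hirr hSP hcol hG₁ hG0 D hXt Y 𝔭 h𝔭).mpr hle

end Package

/-! ### §2 Per pair and colour: Kato's main identity on the `•`-package ⟹ K1's predicate for `•` -/

/-- **K1's predicate `SprungSharpFlatLowerDivisibility W p •` at an X8 pair from the EISENSTEIN HALF of Kato's main identity read on the
`•`-package** — «for every cyclotomic/Honda/newform frame of Sprung 2012 Thm. 2.2, every pinned `I = 𝐇¹_Γ(T_3W)` and every fine dual `Y`, SOME
♯/♭ package datum `d` of colour `•` has `char Y.X ⊆ char (I.H ⧸ d.Z)`» ⟹ for every dual datum `D` of `Sel^•` a generator of `char X^•`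
divisible by `ϖ·L^•`. Sprung 2012 Prop. 7.19 (Eisenstein direction) in the kernel: `h714` makes `D.X` f.g. torsion, `h3` gives the
Néron-normalised `G^•` (`stub_periodMu`), §1 the local inequalities, `exists_generator_eq_periodNormalised_mul_of_lengthAt_quotient_le`
the conclusion. CONDITIONAL on the displayed hypothesis (Kato-type input) and the named facts `h714`, `h3`; closes nothing.
[cite: Sprung2012, Prop. 7.19 and Main Conj. 7.21 (p. 1505), Thm. 7.14 (p. 1504)] [cite: Kato2004Asterisque, Conj. 12.10 (p. 224), §17.13 (p. 280)] -/
theorem sprungSharpFlatLowerDivisibility_of_katoFineInclusion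
    (h714 : thm714_sharpFlatSelmerDual_finite_torsion) (h3 : realPeriodRat_eq_unit_mul_plusPeriod_three)
    (W : WeierstrassCurve ℚ) [W.IsElliptic] [W.IsGloballyMinimal] (p : ℕ) [Fact p.Prime] (hX : ClassX8 W p) (col : Chroma)
    (hKFI : ∀ [ContinuousSMul ℤ_[p] (W.tateModule p)] [Module.Free ℤ_[p] (W.tateModule p)]
        [Module.Finite ℤ_[p] (W.tateModule p)] (κ : ZpExtension ℚ p) (γ : Field.absoluteGaloisGroup ℚ),
        κ.IsCyclotomic → κ.IsTopGenerator γ → IsCyclotomicVariable p γ →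
      ∀ (v : HeightOneSpectrum (𝓞 ℚ)), (p : 𝓞 ℚ) ∈ v.asIdeal →
      ∀ (g : Field.absoluteGaloisGroup (v.adicCompletion ℚ)),
        κ.IsTopGenerator (resGalOfEmb (closureEmb (K := ℚ) (v.adicCompletion ℚ)) g) →
      ∀ (cneg : localPoints W (v.adicCompletion ℚ)) (c : ℕ → localPoints W (v.adicCompletion ℚ)),
        IsHondaSystem κ (closureEmb (K := ℚ) (v.adicCompletion ℚ)) W (W.frobeniusTrace p) g cneg c →
      ∀ (N : ℕ) (_ : NeZero N) (f : CuspForm (Gamma0 N) 2) (ϖ : ℚ),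
        IsNewformOf W f → (ϖ : ℝ) * W.realPeriodRat = plusPeriod f →
      ∀ (I : Kato2004.IwasawaH1Data W p κ γ) (Y : W.FineSelmerDualData κ γ),
        ∃ d : SharpFlatColemanKatoData W p f ϖ κ γ (closureEmb (K := ℚ) (v.adicCompletion ℚ))
            (W.frobeniusTrace p) g c col I,
          Module.charIdeal (IwasawaAlgebra p) Y.X ≤ Module.charIdeal (IwasawaAlgebra p) (I.H ⧸ d.Z)) :
    SprungSharpFlatLowerDivisibility W p col := by
  obtain ⟨hp3, ⟨hgood, hap⟩, -⟩ := id hX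
  subst hp3
  intro κ γ hκ hγ hcv v hv g hg cneg c hH N hN f ϖ Lsharp Lflat hf hϖ hSP hcol D
  haveI : ContinuousSMul ℤ_[3] (W.tateModule 3) := TateModule.continuousSMul_padicInt
  haveI : Module.Free ℤ_[3] (W.tateModule 3) := W.module_free_tateModule_holds 3
  haveI : Module.Finite ℤ_[3] (W.tateModule 3) := W.module_finite_tateModule_holds 3
  haveI : NeZero N := hN
  have hp2 : (3 : ℕ) ≠ 2 := by decide
  have hirr : W.HasIrreducibleModPGaloisRep 3 :=
    hasIrreducibleModPGaloisRep_of_dvd_frobeniusTrace W 3 hp2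
      (W.not_dvd_minimalDiscriminantInt_of_hasGoodReductionAtPrime' 3 hgood) hap
  haveI : Module.Finite (IwasawaAlgebra 3) D.X :=
    h714.moduleFinite hp2 hgood hap hf hκ hγ hcv hv hg hH hSP hcol D
  have hXt : Module.IsTorsion (IwasawaAlgebra 3) D.X :=
    h714.isTorsion hp2 hgood hap hf hκ hγ hcv hv hg hH hSP hcol D
  obtain ⟨I⟩ := Kato2004.nonempty_iwasawaH1Data_holds W 3 κ γ hκ hγ
  obtain ⟨Y⟩ := W.nonempty_fineSelmerDualData κ hγ
  obtain ⟨d, hfine⟩ := hKFI κ γ hκ hγ hcv v hv g hg cneg c hH N hN f ϖ hf hϖ I Y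
  -- the Néron-normalised `G^•` and `G^• ≠ 0`
  obtain ⟨hG, -⟩ := stub_periodMu h3 W 3 hX N hN f ϖ Lsharp Lflat hf hϖ hSP
  obtain ⟨G, hGn⟩ := hG col
  have hϖ0 : ϖ ≠ 0 := hf.periodRatio_ne_zero hϖ
  have hG0 : G ≠ 0 := by
    intro hz
    rw [hz, map_zero, eq_comm, mul_eq_zero] at hGn
    rcases hGn with hC | hL
    · have h1 : ((ϖ : ℚ) : ℚ_[3]) = 0 := by simpa using congrArg PowerSeries.constantCoeff hC
      exact hϖ0 (by exact_mod_cast h1)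
    · exact hcol (iwasawaToPowerSeries_injective 3 (by rw [hL, map_zero]))
  exact exists_generator_eq_periodNormalised_mul_of_lengthAt_quotient_le hXt hGn fun 𝔭 h𝔭 =>
    d.lengthAt_quotient_le_of_fine_charIdeal_le W 3 hirr hSP hcol hGn hG0 D hXt Y hfine 𝔭 h𝔭

/-- **K1's predicate for `•` from Kato's main IDENTITY on the `•`-package** (the shape in which the tree's Kato-type binders conclude —
`Kim2026.thm111_…`, `KimKimSun2020.thm11_…_three_OPEN`, `FouquetWan2021.thm451_katoMainIdentity_OPEN`, there on Kobayashi's package):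
«… SOME package datum `d` of colour `•` with `char Y.X = char (I.H ⧸ d.Z)`» ⟹ `SprungSharpFlatLowerDivisibility W p •`. Immediate from
`…_of_katoFineInclusion` (only `⊆` is used). CONDITIONAL (displayed); closes nothing.
[cite: Sprung2012, Prop. 7.19 and Main Conj. 7.21 (p. 1505)] [cite: Kato2004Asterisque, Conj. 12.10 (p. 224)] [cite: Kobayashi2003, Thm. 7.4 (p. 13)] -/
theorem sprungSharpFlatLowerDivisibility_of_katoMainIdentity
    (h714 : thm714_sharpFlatSelmerDual_finite_torsion) (h3 : realPeriodRat_eq_unit_mul_plusPeriod_three)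
    (W : WeierstrassCurve ℚ) [W.IsElliptic] [W.IsGloballyMinimal] (p : ℕ) [Fact p.Prime] (hX : ClassX8 W p) (col : Chroma)
    (hKMI : ∀ [ContinuousSMul ℤ_[p] (W.tateModule p)] [Module.Free ℤ_[p] (W.tateModule p)]
        [Module.Finite ℤ_[p] (W.tateModule p)] (κ : ZpExtension ℚ p) (γ : Field.absoluteGaloisGroup ℚ),
        κ.IsCyclotomic → κ.IsTopGenerator γ → IsCyclotomicVariable p γ →
      ∀ (v : HeightOneSpectrum (𝓞 ℚ)), (p : 𝓞 ℚ) ∈ v.asIdeal →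
      ∀ (g : Field.absoluteGaloisGroup (v.adicCompletion ℚ)),
        κ.IsTopGenerator (resGalOfEmb (closureEmb (K := ℚ) (v.adicCompletion ℚ)) g) →
      ∀ (cneg : localPoints W (v.adicCompletion ℚ)) (c : ℕ → localPoints W (v.adicCompletion ℚ)),
        IsHondaSystem κ (closureEmb (K := ℚ) (v.adicCompletion ℚ)) W (W.frobeniusTrace p) g cneg c →
      ∀ (N : ℕ) (_ : NeZero N) (f : CuspForm (Gamma0 N) 2) (ϖ : ℚ),
        IsNewformOf W f → (ϖ : ℝ) * W.realPeriodRat = plusPeriod f →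
      ∀ (I : Kato2004.IwasawaH1Data W p κ γ) (Y : W.FineSelmerDualData κ γ),
        ∃ d : SharpFlatColemanKatoData W p f ϖ κ γ (closureEmb (K := ℚ) (v.adicCompletion ℚ))
            (W.frobeniusTrace p) g c col I,
          Module.charIdeal (IwasawaAlgebra p) Y.X = Module.charIdeal (IwasawaAlgebra p) (I.H ⧸ d.Z)) :
    SprungSharpFlatLowerDivisibility W p col :=
  sprungSharpFlatLowerDivisibility_of_katoFineInclusion h714 h3 W p hX col
    fun κ γ hκ hγ hcv v hv g hg cneg c hH N hN f ϖ hf hϖ I Y => by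
      obtain ⟨d, hd⟩ := hKMI κ γ hκ hγ hcv v hv g hg cneg c hH N hN f ϖ hf hϖ I Y
      exact ⟨d, le_of_eq hd⟩

/-! ### §3 Both colours -/

/-- **K1 for BOTH colours at an X8 pair from Kato's main identity read on both ♯/♭ packages** (the identity for every colour `•`, frame,
`I`, `Y`). CONDITIONAL (displayed); closes nothing; with the lead's `katoFineLower_of_lowerDivisibility` (p617250) it also yields `KFL(W)`.
[cite: Sprung2012, Prop. 7.19 and Main Conj. 7.21 (p. 1505)] [cite: Kato2004Asterisque, Conj. 12.10 (p. 224)] -/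
theorem lowerDivisibility_of_katoMainIdentity
    (h714 : thm714_sharpFlatSelmerDual_finite_torsion) (h3 : realPeriodRat_eq_unit_mul_plusPeriod_three)
    (W : WeierstrassCurve ℚ) [W.IsElliptic] [W.IsGloballyMinimal] (p : ℕ) [Fact p.Prime] (hX : ClassX8 W p)
    (hKMI : ∀ (col : Chroma) [ContinuousSMul ℤ_[p] (W.tateModule p)] [Module.Free ℤ_[p] (W.tateModule p)]
        [Module.Finite ℤ_[p] (W.tateModule p)] (κ : ZpExtension ℚ p) (γ : Field.absoluteGaloisGroup ℚ),
        κ.IsCyclotomic → κ.IsTopGenerator γ → IsCyclotomicVariable p γ →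
      ∀ (v : HeightOneSpectrum (𝓞 ℚ)), (p : 𝓞 ℚ) ∈ v.asIdeal →
      ∀ (g : Field.absoluteGaloisGroup (v.adicCompletion ℚ)),
        κ.IsTopGenerator (resGalOfEmb (closureEmb (K := ℚ) (v.adicCompletion ℚ)) g) →
      ∀ (cneg : localPoints W (v.adicCompletion ℚ)) (c : ℕ → localPoints W (v.adicCompletion ℚ)),
        IsHondaSystem κ (closureEmb (K := ℚ) (v.adicCompletion ℚ)) W (W.frobeniusTrace p) g cneg c →
      ∀ (N : ℕ) (_ : NeZero N) (f : CuspForm (Gamma0 N) 2) (ϖ : ℚ),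
        IsNewformOf W f → (ϖ : ℝ) * W.realPeriodRat = plusPeriod f →
      ∀ (I : Kato2004.IwasawaH1Data W p κ γ) (Y : W.FineSelmerDualData κ γ),
        ∃ d : SharpFlatColemanKatoData W p f ϖ κ γ (closureEmb (K := ℚ) (v.adicCompletion ℚ))
            (W.frobeniusTrace p) g c col I,
          Module.charIdeal (IwasawaAlgebra p) Y.X = Module.charIdeal (IwasawaAlgebra p) (I.H ⧸ d.Z)) :
    ∀ col : Chroma, SprungSharpFlatLowerDivisibility W p col :=
  fun col => sprungSharpFlatLowerDivisibility_of_katoMainIdentity h714 h3 W p hX col (hKMI col)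

end Summit.BirchSwinnertonDyer.BirchSwinnertonDyer.Theorems.ChromaticCommonZeros

end
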